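import Literature.MathematicalPhysics.StatisticalMechanics.ComplexSpinTwoPointThermodynamicLimit
import Literature.MathematicalPhysics.StatisticalMechanics.ComplexSpinInfraredBoundThermodynamicLimit
import Literature.MathematicalPhysics.StatisticalMechanics.ComplexSpinMeanFieldBound
import Literature.MathematicalPhysics.StatisticalMechanics.ComplexSpinSchwingerDysonSharp
import HarnessLib

/-!
# Correlations bounded by one and chiral long-range order in the infinite volume for `U(N)`,
# EVERY `N`: Salmhofer–Seiler's Thm. 3.18 (1)–(2), Cor. 4.9 and Remark 4.10 (1) in the dimer picture
# (CMP 139 (1991), Thm. 3.18 (3.59)–(3.65), Cor. 4.9, Remark 4.10 (1) (4.43), Remark 4.6)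

Theorems only (no definition, no named fact).  The tree proves Thm. 3.18 (1) `0 ≤ ⟨σ^L⟩_Λ ≤ 1`
(`expect_monomial_mem_Icc`, `ComplexSpinCorrelationBound`), Thm. 3.18 (2) (thermodynamic limits along
subsequences, `exists_subseq_tendsto_expect`) and the infinite-volume Cor. 4.9 / Remark 4.10 (1)
(`uN_chiralLRO_thermodynamicLimit`, `uN_chiralLRO_infiniteVolume`) under the printed hypothesis of
Thm. 3.18, `B = exp(NW)` to order `N` with `w₁ = 1` and `w_k ≥ 0` — which for the `U(N)` model is
Remark 4.6, available in the tree for `N ≤ 4` only (`uNLogCoeff_nonneg`).  The one place where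
`w_k ≥ 0` enters is the one-dimer domination (3.61)–(3.62), `[σ_xσ_yΦ]_Λ ≤ [Φ]_Λ`, read off the
Schwinger–Dyson equation (3.46) in its `W`-form.  This file reads the same equation in the
`a`-form of the bond weight `B(t) = ∑_n a_n tⁿ` (the monomer–dimer picture of (2.21)–(2.23)), where
the one-bond term of `σ_x∂_x` acting on the Boltzmann polynomial is the top coefficient of
`(∑_n n a_n (σ_xσ_y)ⁿ)·Φ·R` (`R` = all the other weights) and is therefore nonnegative as soon as
`a_n ≥ 0`, and where `∑_n n a_n tⁿ - c·t·B(t) = ∑_n (n a_n - c a_{n-1}) tⁿ` (modulo `t^{N+1}`, which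
does not reach the top coefficient): **(3.62) holds with `[σ_xσ_yΦ] ≤ (N/c)[Φ]` whenever
`c a_{n-1} ≤ n a_n` (`1 ≤ n ≤ N`)**, with no condition on `W = log B`.  For `U(N)` the dimer
weights `a_n = N^{2n}(N-n)!/(n!N!)` of (2.23) satisfy `n a_n (N-n+1) = N² a_{n-1}`
(`uNBondCoeff_ratio`), hence `N a_{n-1} ≤ n a_n`, i.e. `c = N`: (3.62) and with it Thm. 3.18 (1)–(2)
hold for `U(N)` with EVERY `N ≥ 1`.  Combined with the tree's all-`N` finite-volume chiral
long-range order `uN_chiralLRO_allN` (`ComplexSpinSchwingerDysonSharp`: the Schwinger–Dyson constant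
`K(N)` of (4.38) replaced by `N`, and the kernel certificate `S(ν) < 7/20` for `ν ≥ 4`) and the
tree's `a`-form of Thm. 3.23 (1) (`thermodynamicLimit_twoPoint_decomp`, hypotheses `b_k ≥ 0` —
Remark 4.5, `uN_fluctCoeff_nonneg`, every `N` — and `|T_Λ| ≤ 1`), this gives the printed
infinite-volume statements for every `N`:

* `natCast_mul_bracket_omega_mul`, `bracket_omega_mul_nonneg` — the one-bond Schwinger–Dyson term
  `N[ω_y Φ]_Λ` as a top coefficient; `≥ 0` for `a_n ≥ 0`, `m ≥ 0`, `Φ ≥ 0` (coefficientwise);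
* **`bracket_X_mul_X_nbr_mul_le_of_ratio`** — (3.61)–(3.62) in the `a`-form:
  `c[σ_xσ_yΦ]_Λ ≤ N[Φ]_Λ` if `c a_{n-1} ≤ n a_n`; **`uN_bracket_X_mul_X_nbr_mul_le`** — (3.62)
  `[σ_xσ_yΦ]_Λ ≤ [Φ]_Λ` for `U(N)`, every `N ≥ 1`;
* `bracket_mul_prod_dimer_le_of_dom`, …, `expect_monomial_mem_Icc_of_dom` — the chain
  (3.63)–(3.65) ⇒ Thm. 3.18 (1), run from the one-dimer domination as a hypothesis (proofs as in
  `ComplexSpinCorrelationBound`); **`uN_expect_monomial_mem_Icc_allN`**, `uN_corrFn_mem_Icc_allN` —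
  **Thm. 3.18 (1) `0 ≤ ⟨σ^L⟩_Λ ≤ 1` for `U(N)`, every `N ≥ 1`** (`m ≥ 0`, even torus);
* `exists_subseq_tendsto_expect_of_Icc`, **`uN_exists_subseq_tendsto_expect_allN`**,
  `uN_exists_subseq_tendsto_corrFn_allN` — Thm. 3.18 (2) for `U(N)`, every `N`;
* `chiralLRO_thermodynamicLimit_of_lowerBound` — Thm. 4.8 / Remark 4.10 (1) in the thermodynamic
  limit from: `b_k ≥ 0`, `0 ≤ T_Λ ≤ 1`, and a uniform finite-volume lower bound `c ≤ |Λ|⁻¹∑_x T_Λ(x)`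
  (proof as in `chiralLRO_thermodynamicLimit`);
* **`uN_chiralLRO_thermodynamicLimit_allN`**, **`uN_chiralLRO_infiniteVolume_allN`** — **Cor. 4.9
  with Remark 4.10 (1) (4.43) for `U(N)`, EVERY `N ≥ 1`, `ν ≥ 4`**: every thermodynamic limit `T` of
  `⟨σ₀σ_x⟩_Λ` at `m = 0` along even tori vanishes on the even sublattice and tends to
  `2c₀ = limsup_x T(x) ≥ 3/(40νN) > 0` along the odd one; such limits exist along subsequences.

* (appended) `bracket_X_mul_X_nbr_mul_le_omega_of_ratio`, `sd_nbr_sum_le_of_ratio`,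
  `uN_sd_nbr_sum_le` — the one-bond comparison `c[σ_xσ_yΦ] ≤ N[ω_yΦ]` and (3.61)/(4.10)
  `2m[σ_x] + ∑_y[σ_xσ_y] ≤ Z_Λ` for `U(N)`, every `N`; `meanField_ineq_of_sd`,
  **`uN_meanField_ineq_allN`**, `uN_expect_X_le_meanField_allN`, `uN_expect_X_nonneg_allN`,
  `uN_expect_X_le_inv_sqrt_allN`, `uN_condensate_le_min_allN` — **Thm. 4.3 (4.6)–(4.7) and Cor. 4.4
  (1), (3) (4.16), (4.18) for `U(N)`, EVERY `N ≥ 1`** (mean field bounds the condensate,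
  `⟨ψ̄ψ⟩_Λ ≤ N min{√(2/ν), 1/m}`), in every finite even volume; `uN_thermodynamicLimit_infraredBound_allN`
  — Thm. 3.21 / (3.109) for every thermodynamic limit, every `N` (needs only `b_k ≥ 0`, Remark 4.5).

Honest framing: `β = 0` complex spin systems (the bosonised strong-coupling `U(N)` lattice gauge
theory with one staggered fermion, Salmhofer–Seiler §2) on even tori `(ℤ/L)^ν` and their pointwise
thermodynamic limits; the removal of `N ≤ 4` is the tree's (the print has Cor. 4.9 for `N ≤ 3, 4`
with the computer-assisted Prop. 4.2 (4), and Thm. 3.18 under Remark 4.6); nothing here is about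
`β > 0`, `SU(N)`, several flavours, the continuum, or the summit's `QCD` conjunct / a mass gap.

## References

* M. Salmhofer, E. Seiler, *Proof of chiral symmetry breaking in strongly coupled lattice gauge
  theory*, Commun. Math. Phys. 139 (1991) 395–432: (2.21)–(2.23), (3.44)–(3.46), Thm. 3.18
  (3.59)–(3.65), Thm. 3.21, Thm. 3.23 (1), Thm. 4.3 (4.6)–(4.7), Cor. 4.4, (4.10), Thm. 4.8,
  Cor. 4.9, Remark 4.10 (1) (4.43), Remarks 4.5–4.6.
  [SalmhoferSeiler1991]

## Mathlib

`MvPolynomial.coeff_monomial_mul'`; `isCompact_univ_pi`, `IsCompact.isSeqCompact`, `tendsto_pi_nhds`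
(Thm. 3.18 (2)); `Filter.limsup_le_of_le`, `Filter.le_limsup_of_frequently_le`.
-/

noncomputable section

open MvPolynomial Finset Filter Topology
open Literature.Probability.LatticeModels
open Literature.Barriers.CriticalPhenomena.NonGibbs

namespace Literature.MathematicalPhysics.StatisticalMechanics

namespace ComplexSpin

/-! ### The one-bond Schwinger–Dyson term in the `a`-form; (3.61)–(3.62) from `c a_{n-1} ≤ n a_n` -/

section OneBond

variable {ν L : ℕ} [NeZero L]

/-- The top coefficient `(N,…,N)` of `(σ_xσ_y)^{N+1}·q` vanishes ("`σ_x^{N+1}` in the numerator").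
[cite: SalmhoferSeiler1991, proof of (3.44)] -/
private theorem coeff_top_XX_pow_succ_mul (N : ℕ) (x y : TorusSite ν L)
    (q : MvPolynomial (TorusSite ν L) ℝ) :
    coeff (topExponent N) ((X x * X y) ^ (N + 1) * q) = 0 := by
  classical
  have hm : ((X x * X y) ^ (N + 1) : MvPolynomial (TorusSite ν L) ℝ) =
      monomial (Finsupp.single x (N + 1) + Finsupp.single y (N + 1)) 1 := by
    rw [mul_pow, X_pow_eq_monomial, X_pow_eq_monomial, monomial_mul, mul_one]
  rw [hm, coeff_monomial_mul']
  split_ifs with h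
  · exfalso
    have hx := Finsupp.le_def.1 h x
    rw [Finsupp.add_apply, Finsupp.single_eq_same, topExponent_apply'] at hx
    omega
  · rfl

omit [NeZero L] in
/-- A product with a high factor (`σ_z`-degree `> N` in every term) has no `∏_x σ_x^N` coefficient.
[cite: SalmhoferSeiler1991, proof of (3.44)] -/
private theorem coeff_mul_eq_zero_of_highDeg' {N : ℕ} {z : TorusSite ν L}
    {p : MvPolynomial (TorusSite ν L) ℝ} (hp : HighDeg N z p) (q : MvPolynomial (TorusSite ν L) ℝ)
    {d : TorusSite ν L →₀ ℕ} (hd : d z = N) : coeff d (p * q) = 0 := by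
  classical
  rw [coeff_mul]
  refine Finset.sum_eq_zero fun e he => ?_
  by_cases h1 : coeff e.1 p = 0
  · rw [h1, zero_mul]
  · exfalso
    have hlt := hp e.1 h1
    have he' : e.1 + e.2 = d := by simpa [Finset.mem_antidiagonal] using he
    have : e.1 z ≤ d z := by rw [← he', Finsupp.add_apply]; omega
    omega

omit [NeZero L] in
/-- `σ_z∂_z` preserves nonnegativity of the coefficients. [cite: SalmhoferSeiler1991, proof of Thm. 3.18 (1), (3.61)] -/
private theorem nonnegCoeff_euler' {Φ : MvPolynomial (TorusSite ν L) ℝ} (hΦ : NonnegCoeff Φ)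
    (z : TorusSite ν L) : NonnegCoeff (euler z Φ) :=
  fun d => by rw [coeff_euler]; exact mul_nonneg (Nat.cast_nonneg _) (hΦ d)

/-- **The one-bond Schwinger–Dyson term in the monomer–dimer picture.**  For `B = exp(NW)` to order
`N` (`HasLog N a w`, ANY `w`), every site `x`, each neighbour `y = x ± e_μ` (side `L ≥ 2`) and every
observable `Φ`: `N[ω_y Φ]_Λ = [ (∑_{n ≤ N} n a_n (σ_xσ_y)ⁿ) · Φ · R ]_{(N,…,N)}`, where
`ω_y = σ_xσ_y W'(σ_xσ_y)` is the bond term of (3.46) and `R` is the product of all site weights and of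
the weights of all the other bonds — because `σ_x∂_x B(σ_xσ_y) = ∑ n a_n (σ_xσ_y)ⁿ = N ω_y B + `(terms
of `σ_x`-degree `> N`) by (3.44). [cite: SalmhoferSeiler1991, (3.44)–(3.46) with (2.21)–(2.23)] -/
theorem natCast_mul_bracket_omega_mul {N : ℕ} {a w : ℕ → ℝ} (hlog : HasLog N a w) (hL : 2 ≤ L)
    (m : ℝ) (x : TorusSite ν L) (s : Fin ν × Bool) (Φ : MvPolynomial (TorusSite ν L) ℝ) :
    (N : ℝ) * bracket N m a (omega N w x (nbr x s) * Φ) =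
      coeff (topExponent N)
        ((∑ k ∈ range (N + 1), C ((k : ℝ) * a k) * (X x * X (nbr x s)) ^ k) *
          (Φ * ((∏ z : TorusSite ν L, siteWeight N m z) *
            ∏ p ∈ Finset.univ.erase (linkOf x s), bondWeight N a p.1 (p.1 + Pi.single p.2 1)))) := by
  have hxy : x ≠ nbr x s := nbr_ne_self hL x s
  have hbolt := boltzmann_eq_bondWeight_mul N m a x s
  obtain ⟨h, hh, hE⟩ := euler_bondWeight_left (ν := ν) (L := L) hlog hxy
  rw [euler_bondWeight_eq_sum N a hxy] at hE
  set y := nbr x s with hy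
  set T : MvPolynomial (TorusSite ν L) ℝ := X x * X y with hT
  set R := (∏ z : TorusSite ν L, siteWeight N m z) *
    ∏ p ∈ Finset.univ.erase (linkOf x s), bondWeight N a p.1 (p.1 + Pi.single p.2 1) with hR
  have h1 : (N : ℝ) * bracket N m a (omega N w x y * Φ) =
      coeff (topExponent N) ((C (N : ℝ) * omega N w x y * bondWeight N a x y) * (Φ * R)) := by
    rw [← bracket_C_mul, bracket, hbolt]
    congr 1
    ring
  have h2 : C (N : ℝ) * omega N w x y * bondWeight N a x y =
      (∑ k ∈ range (N + 1), C ((k : ℝ) * a k) * T ^ k) - h := by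
    linear_combination -hE
  have h3 : coeff (topExponent N) (h * (Φ * R)) = 0 :=
    coeff_mul_eq_zero_of_highDeg' hh _ (topExponent_apply' N x)
  rw [h1, h2, sub_mul, coeff_sub, h3, sub_zero]

/-- **The one-bond Schwinger–Dyson term is nonnegative in the dimer picture**: for `a_n ≥ 0`
(`n ≤ N`), `m ≥ 0` and `Φ` with nonnegative coefficients, `[ω_y Φ]_Λ ≥ 0` — with NO hypothesis on
the signs of the `w_k` (for `U(N)`: every `N`). [cite: SalmhoferSeiler1991, (3.46) and (3.61) with (2.23)] -/
theorem bracket_omega_mul_nonneg {N : ℕ} {a w : ℕ → ℝ} (hlog : HasLog N a w)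
    (ha : ∀ k ≤ N, 0 ≤ a k) (hL : 2 ≤ L) {m : ℝ} (hm : 0 ≤ m) (x : TorusSite ν L)
    (s : Fin ν × Bool) {Φ : MvPolynomial (TorusSite ν L) ℝ} (hΦ : NonnegCoeff Φ) :
    0 ≤ bracket N m a (omega N w x (nbr x s) * Φ) := by
  rcases Nat.eq_zero_or_pos N with rfl | hN
  · have hω : omega (ν := ν) (L := L) 0 w x (nbr x s) = 0 := by unfold omega; simp
    rw [hω, zero_mul, bracket_zero]
  · have hNpos : (0 : ℝ) < N := Nat.cast_pos.mpr hN
    have h := natCast_mul_bracket_omega_mul hlog hL m x s Φ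
    have hB : NonnegCoeff
        (∑ k ∈ range (N + 1), C ((k : ℝ) * a k) * (X x * X (nbr x s)) ^ k) :=
      NonnegCoeff.sum _ fun k hk =>
        (NonnegCoeff.C (mul_nonneg (Nat.cast_nonneg k)
          (ha k (Nat.lt_succ_iff.mp (Finset.mem_range.mp hk))))).mul
          (((NonnegCoeff.X x).mul (NonnegCoeff.X _)).pow k)
    have hnn := (hB.mul (hΦ.mul (nonnegCoeff_cofactor N hm ha x s))) (topExponent N)
    rw [← h] at hnn
    exact (mul_nonneg_iff_of_pos_left hNpos).mp hnn

set_option maxHeartbeats 400000 in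
/-- **The one-bond comparison in the monomer–dimer picture.**  For `B = exp(NW)` to order `N` (ANY
`w`), `a_n ≥ 0`, `c a_{n-1} ≤ n a_n` (`1 ≤ n ≤ N`), `m ≥ 0`, side `L ≥ 2`, every site `x`, each
neighbour `y` and every `Φ` with nonnegative coefficients: `c [σ_xσ_y Φ]_Λ ≤ N [ω_y Φ]_Λ` — because
`∑_n n a_n tⁿ - c t B(t) = ∑_{n=1}^{N} (n a_n - c a_{n-1}) tⁿ - c a_N t^{N+1}` has nonnegative
coefficients up to the last term, which does not reach the top coefficient.  (For `U(N)`, `c = N`: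
`[σ_xσ_yΦ] ≤ [ω_yΦ]`, the converse of `uN_bracket_omega_mul_le`'s `[ω_yΦ] ≤ N[σ_xσ_yΦ]`.)
[cite: SalmhoferSeiler1991, (3.44)–(3.46) with (2.23)] -/
theorem bracket_X_mul_X_nbr_mul_le_omega_of_ratio {N : ℕ} {a w : ℕ → ℝ} (hlog : HasLog N a w)
    (ha : ∀ k ≤ N, 0 ≤ a k) {c : ℝ}
    (hc : ∀ n, 1 ≤ n → n ≤ N → c * a (n - 1) ≤ (n : ℝ) * a n) (hL : 2 ≤ L) {m : ℝ} (hm : 0 ≤ m)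
    (x : TorusSite ν L) (s : Fin ν × Bool) {Φ : MvPolynomial (TorusSite ν L) ℝ}
    (hΦ : NonnegCoeff Φ) :
    c * bracket N m a (X x * X (nbr x s) * Φ) ≤
      (N : ℝ) * bracket N m a (omega N w x (nbr x s) * Φ) := by
  have hxy : x ≠ nbr x s := nbr_ne_self hL x s
  have hRnn := nonnegCoeff_cofactor N hm ha x s
  have hbolt := boltzmann_eq_bondWeight_mul N m a x s
  have h1 := natCast_mul_bracket_omega_mul hlog hL m x s Φ
  have h4 := C_mul_XX_mul_bondWeight_eq N a c x (nbr x s)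
  set y := nbr x s with hy
  set T : MvPolynomial (TorusSite ν L) ℝ := X x * X y with hT
  set R := (∏ z : TorusSite ν L, siteWeight N m z) *
    ∏ p ∈ Finset.univ.erase (linkOf x s), bondWeight N a p.1 (p.1 + Pi.single p.2 1) with hR
  have hTnn : NonnegCoeff T := (NonnegCoeff.X x).mul (NonnegCoeff.X y)
  have h6 : c * bracket N m a (T * Φ) =
      coeff (topExponent N) (C c * T * bondWeight N a x y * (Φ * R)) := by
    rw [bracket, hbolt, ← coeff_C_mul]
    congr 1
    ring
  have hD : NonnegCoeff
      (∑ k ∈ range N, C (((k + 1 : ℕ) : ℝ) * a (k + 1) - c * a k) * T ^ (k + 1)) := by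
    refine NonnegCoeff.sum _ fun k hk => (NonnegCoeff.C ?_).mul (hTnn.pow _)
    have hk' : k < N := Finset.mem_range.mp hk
    have := hc (k + 1) (by omega) (by omega)
    rw [Nat.add_sub_cancel] at this
    linarith
  have hneg : (∑ k ∈ range N, C (c * a k - ((k + 1 : ℕ) : ℝ) * a (k + 1)) * T ^ (k + 1)) =
      -(∑ k ∈ range N, C (((k + 1 : ℕ) : ℝ) * a (k + 1) - c * a k) * T ^ (k + 1)) := by
    rw [← Finset.sum_neg_distrib]
    refine Finset.sum_congr rfl fun k _ => ?_
    rw [← neg_mul, ← map_neg, neg_sub]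
  have h5 : 0 ≤ coeff (topExponent N)
      ((∑ k ∈ range N, C (((k + 1 : ℕ) : ℝ) * a (k + 1) - c * a k) * T ^ (k + 1)) * (Φ * R)) :=
    (hD.mul (hΦ.mul hRnn)) _
  have h7 : coeff (topExponent N) (C (c * a N) * T ^ (N + 1) * (Φ * R)) = 0 := by
    rw [mul_assoc, coeff_C_mul, hT, coeff_top_XX_pow_succ_mul, mul_zero]
  rw [h6, h4, add_mul, add_mul, coeff_add, coeff_add, ← h1, h7, add_zero, hneg, neg_mul, coeff_neg]
  linarith

/-- **(3.61)–(3.62) in the monomer–dimer picture.**  Let `B = exp(NW)` to order `N` (ANY `w`),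
`a_n ≥ 0`, and `c a_{n-1} ≤ n a_n` for `1 ≤ n ≤ N`; let `m ≥ 0`, side `L ≥ 2`.  Then for every site
`x`, each neighbour `y` and every `Φ` with nonnegative coefficients: `c [σ_xσ_y Φ]_Λ ≤ N [Φ]_Λ`.
Proof: in the SD equation (3.46)/(3.61) `N[Φ] = [σ_x∂_xΦ] + 2Nm[σ_xΦ] + N∑_{y'}[ω_{y'}Φ]` every term is
`≥ 0` (`bracket_omega_mul_nonneg`), so `N[Φ] ≥ N[ω_yΦ] = [(∑ n a_n (σ_xσ_y)ⁿ)ΦR]_{top}`, and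
`∑_n n a_n tⁿ - c t B(t) = ∑_{n=1}^{N} (n a_n - c a_{n-1}) tⁿ - c a_N t^{N+1}` has nonnegative
coefficients up to the top-irrelevant last term, so `N[ω_yΦ] ≥ c[σ_xσ_yΦ]`.  (The print uses the
`W`-form `ω_y ≥ w₁σ_xσ_y` coefficientwise, i.e. `w_k ≥ 0`.) [cite: SalmhoferSeiler1991, Thm. 3.18 (1), (3.61)–(3.62) with (3.44) and (2.23)] -/
theorem bracket_X_mul_X_nbr_mul_le_of_ratio {N : ℕ} {a w : ℕ → ℝ} (hlog : HasLog N a w)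
    (ha : ∀ k ≤ N, 0 ≤ a k) {c : ℝ}
    (hc : ∀ n, 1 ≤ n → n ≤ N → c * a (n - 1) ≤ (n : ℝ) * a n) (hL : 2 ≤ L) {m : ℝ} (hm : 0 ≤ m)
    (x : TorusSite ν L) (s : Fin ν × Bool) {Φ : MvPolynomial (TorusSite ν L) ℝ}
    (hΦ : NonnegCoeff Φ) :
    c * bracket N m a (X x * X (nbr x s) * Φ) ≤ (N : ℝ) * bracket N m a Φ := by
  have step1 := bracket_X_mul_X_nbr_mul_le_omega_of_ratio hlog ha hc hL hm x s hΦ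
  -- the other terms of the SD equation are nonnegative
  have hsd := schwingerDyson (ν := ν) (L := L) hlog hL m x Φ
  have he : 0 ≤ bracket N m a (euler x Φ) := bracket_nonneg N hm ha (nonnegCoeff_euler' hΦ x)
  have hX : 0 ≤ bracket N m a (X x * Φ) := bracket_nonneg N hm ha ((NonnegCoeff.X x).mul hΦ)
  have hsum : bracket N m a (omega N w x (nbr x s) * Φ) ≤ bracket N m a (linkSum N w x * Φ) := by
    rw [linkSum_eq_sum_nbr, Finset.sum_mul, bracket_sum]
    exact Finset.single_le_sum (f := fun s' => bracket N m a (omega N w x (nbr x s') * Φ))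
      (fun s' _ => bracket_omega_mul_nonneg hlog ha hL hm x s' hΦ) (Finset.mem_univ s)
  have hNnn : (0 : ℝ) ≤ N := Nat.cast_nonneg N
  have h2' : 0 ≤ 2 * (N : ℝ) * m * bracket N m a (X x * Φ) := by positivity
  calc c * bracket N m a (X x * X (nbr x s) * Φ)
      ≤ (N : ℝ) * bracket N m a (omega N w x (nbr x s) * Φ) := step1
    _ ≤ (N : ℝ) * bracket N m a (linkSum N w x * Φ) := mul_le_mul_of_nonneg_left hsum hNnn
    _ ≤ (N : ℝ) * bracket N m a Φ := by linarith

end OneBond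

/-! ### (3.63)–(3.65) and Theorem 3.18 (1) from the one-dimer domination -/

section Chain

variable {ν L : ℕ} [NeZero L]

/-- Iteration of (3.62) over any family of dimers `(l.1, l.1 + e_{l.2})` with multiplicities, from
the one-dimer domination `[σ_xσ_yΦ]_Λ ≤ [Φ]_Λ` as a hypothesis:
`[Φ · ∏_l (σ_{l.1}σ_{l.1+e_{l.2}})^{k_l}]_Λ ≤ [Φ]_Λ` for `Φ` with nonnegative coefficients.
[cite: SalmhoferSeiler1991, Thm. 3.18 (1), (3.62)–(3.64)] -/
theorem bracket_mul_prod_dimer_le_of_dom {N : ℕ} {m : ℝ} {a : ℕ → ℝ}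
    (hdom : ∀ (x : TorusSite ν L) (s : Fin ν × Bool) (Φ : MvPolynomial (TorusSite ν L) ℝ),
      NonnegCoeff Φ → bracket N m a (X x * X (nbr x s) * Φ) ≤ bracket N m a Φ)
    (T : Finset (TorusSite ν L × Fin ν)) (k : TorusSite ν L × Fin ν → ℕ)
    {Φ : MvPolynomial (TorusSite ν L) ℝ} (hΦ : NonnegCoeff Φ) :
    bracket N m a (Φ * ∏ l ∈ T, (X l.1 * X (l.1 + Pi.single l.2 1)) ^ k l) ≤ bracket N m a Φ := by
  classical
  -- peeling one factor `σ_xσ_{x+e_μ}` at a time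
  have peel : ∀ (l : TorusSite ν L × Fin ν) (n : ℕ) (Ψ : MvPolynomial (TorusSite ν L) ℝ),
      NonnegCoeff Ψ →
        bracket N m a (Ψ * (X l.1 * X (l.1 + Pi.single l.2 1)) ^ n) ≤ bracket N m a Ψ := by
    intro l n
    induction n with
    | zero => intro Ψ _; rw [pow_zero, mul_one]
    | succ n ih =>
      intro Ψ hΨ
      have hnn : NonnegCoeff (Ψ * (X l.1 * X (l.1 + Pi.single l.2 1)) ^ n) :=
        hΨ.mul (((NonnegCoeff.X _).mul (NonnegCoeff.X _)).pow n)
      have h := hdom l.1 (l.2, true) _ hnn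
      have hnbr : nbr l.1 (l.2, true) = l.1 + Pi.single l.2 1 := by simp [nbr]
      rw [hnbr] at h
      calc bracket N m a (Ψ * (X l.1 * X (l.1 + Pi.single l.2 1)) ^ (n + 1))
          = bracket N m a (X l.1 * X (l.1 + Pi.single l.2 1) *
              (Ψ * (X l.1 * X (l.1 + Pi.single l.2 1)) ^ n)) := by
            rw [pow_succ]; ring_nf
        _ ≤ bracket N m a (Ψ * (X l.1 * X (l.1 + Pi.single l.2 1)) ^ n) := h
        _ ≤ bracket N m a Ψ := ih Ψ hΨ
  induction T using Finset.induction_on generalizing Φ with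
  | empty => rw [Finset.prod_empty, mul_one]
  | @insert l T hl ih =>
    rw [Finset.prod_insert hl]
    have hnn : NonnegCoeff (Φ * ∏ l' ∈ T, (X l'.1 * X (l'.1 + Pi.single l'.2 1)) ^ k l') :=
      hΦ.mul (NonnegCoeff.prod _ fun l' _ => ((NonnegCoeff.X _).mul (NonnegCoeff.X _)).pow _)
    calc bracket N m a (Φ * ((X l.1 * X (l.1 + Pi.single l.2 1)) ^ k l *
            ∏ l' ∈ T, (X l'.1 * X (l'.1 + Pi.single l'.2 1)) ^ k l'))
        = bracket N m a ((Φ * ∏ l' ∈ T, (X l'.1 * X (l'.1 + Pi.single l'.2 1)) ^ k l') *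
            (X l.1 * X (l.1 + Pi.single l.2 1)) ^ k l) := by ring_nf
      _ ≤ bracket N m a (Φ * ∏ l' ∈ T, (X l'.1 * X (l'.1 + Pi.single l'.2 1)) ^ k l') :=
          peel l (k l) _ hnn
      _ ≤ bracket N m a Φ := ih hΦ

/-- **(3.64)** from the one-dimer domination: `[∏_x σ_x^{l+1}]_Λ ≤ [∏_x σ_x^l]_Λ` (even torus,
`ν ≥ 1`; the dimer cover (3.63) is `prod_X_eq_prod_dimer`). [cite: SalmhoferSeiler1991, Thm. 3.18 (1), (3.63)–(3.64)] -/
theorem bracket_prod_X_pow_succ_le_of_dom (hν : 1 ≤ ν) (hL : Even L) {N : ℕ} {m : ℝ} {a : ℕ → ℝ}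
    (hdom : ∀ (x : TorusSite ν L) (s : Fin ν × Bool) (Φ : MvPolynomial (TorusSite ν L) ℝ),
      NonnegCoeff Φ → bracket N m a (X x * X (nbr x s) * Φ) ≤ bracket N m a Φ) (l : ℕ) :
    bracket N m a (∏ x : TorusSite ν L, X x ^ (l + 1)) ≤
      bracket N m a (∏ x : TorusSite ν L, X x ^ l) := by
  have hsplit : (∏ x : TorusSite ν L, X x ^ (l + 1) : MvPolynomial (TorusSite ν L) ℝ) =
      (∏ x : TorusSite ν L, X x ^ l) * ∏ x : TorusSite ν L, X x := by
    rw [← Finset.prod_mul_distrib]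
    refine Finset.prod_congr rfl fun x _ => ?_
    rw [pow_succ]
  rw [hsplit, prod_X_eq_prod_dimer hL.two_dvd ⟨0, hν⟩]
  exact bracket_mul_prod_dimer_le_of_dom hdom _ _
    (NonnegCoeff.prod _ fun x _ => (NonnegCoeff.X x).pow l)

/-- **(3.64), iterated**, from the one-dimer domination: `[∏_x σ_x^l]_Λ ≤ [1]_Λ = Z_Λ` for every
`l`. [cite: SalmhoferSeiler1991, Thm. 3.18 (1), (3.64)] -/
theorem bracket_prod_X_pow_le_partitionFunction_of_dom (hν : 1 ≤ ν) (hL : Even L) {N : ℕ}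
    {m : ℝ} {a : ℕ → ℝ}
    (hdom : ∀ (x : TorusSite ν L) (s : Fin ν × Bool) (Φ : MvPolynomial (TorusSite ν L) ℝ),
      NonnegCoeff Φ → bracket N m a (X x * X (nbr x s) * Φ) ≤ bracket N m a Φ) (l : ℕ) :
    bracket N m a (∏ x : TorusSite ν L, X x ^ l) ≤ partitionFunction (ν := ν) (L := L) N m a := by
  induction l with
  | zero => simp only [pow_zero, Finset.prod_const_one, partitionFunction, le_refl]
  | succ l ih => exact (bracket_prod_X_pow_succ_le_of_dom hν hL hdom l).trans ih

/-- **`[σ^e]_Λ ≤ Z_Λ` for every monomial** ((3.65) with (3.64)) from the one-dimer domination and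
`a_n ≥ 0`, `m ≥ 0`: the chessboard bound `chessboard_cfg` (reflection positivity (3.54) for
monomials, `bracket_prod_X_pow_sq_le`, needs only `a_n ≥ 0`) reduces `σ^e` to some `∏_x σ_x^l`.
[cite: SalmhoferSeiler1991, Thm. 3.18 (1), (3.57) and (3.64)–(3.65)] -/
theorem bracket_prod_X_pow_le_partitionFunction_of_dom' (hν : 1 ≤ ν) (hL : Even L) {N : ℕ}
    {m : ℝ} (hm : 0 ≤ m) {a : ℕ → ℝ} (ha : ∀ j ≤ N, 0 ≤ a j)
    (hdom : ∀ (x : TorusSite ν L) (s : Fin ν × Bool) (Φ : MvPolynomial (TorusSite ν L) ℝ),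
      NonnegCoeff Φ → bracket N m a (X x * X (nbr x s) * Φ) ≤ bracket N m a Φ)
    (e : TorusSite ν L → ℕ) :
    bracket N m a (∏ x, X x ^ e x) ≤ partitionFunction (ν := ν) (L := L) N m a := by
  classical
  set F : (TorusSite ν L → ℂ) → ℝ := fun ψ => bracket N m a (∏ x, X x ^ ⌊(ψ x).re⌋₊) with hF
  set S : Finset ℂ := Finset.univ.image fun x : TorusSite ν L => ((e x : ℝ) : ℂ) with hSdef
  have hS : ∀ c ∈ S, starRingEnd ℂ c ∈ S := by
    intro c hc
    obtain ⟨x, -, rfl⟩ := Finset.mem_image.1 hc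
    rw [Complex.conj_ofReal]
    exact Finset.mem_image_of_mem _ (Finset.mem_univ x)
  have h0 : ∀ ψ, 0 ≤ F ψ := fun ψ =>
    bracket_nonneg N hm ha (NonnegCoeff.prod _ fun x _ => (NonnegCoeff.X x).pow _)
  have hcs : ∀ (i : Fin ν) (k : ZMod L) (ψ : TorusSite ν L → ℂ), (∀ y, ψ y ∈ S) →
      F ψ ^ 2 ≤ F (cfgSymP i k ψ) * F (cfgSymM i k ψ) := by
    intro i k ψ _
    have h := bracket_prod_X_pow_sq_le hL i k m ha (fun x => ⌊(ψ x).re⌋₊)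
    have hP : (∏ x, X x ^ ⌊(cfgSymP i k ψ x).re⌋₊ : MvPolynomial (TorusSite ν L) ℝ) =
        ∏ x, X x ^ (if x ∈ halfPlus L i k then ⌊(ψ x).re⌋₊ else ⌊(ψ (siteReflect i k x)).re⌋₊) :=
      Finset.prod_congr rfl fun x _ => by
        unfold cfgSymP
        split_ifs <;> simp [Complex.conj_re]
    have hM : (∏ x, X x ^ ⌊(cfgSymM i k ψ x).re⌋₊ : MvPolynomial (TorusSite ν L) ℝ) =
        ∏ x, X x ^ (if x ∈ halfMinus L i k then ⌊(ψ x).re⌋₊ else ⌊(ψ (siteReflect i k x)).re⌋₊) :=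
      Finset.prod_congr rfl fun x _ => by
        unfold cfgSymM
        split_ifs <;> simp [Complex.conj_re]
    show bracket N m a (∏ x, X x ^ ⌊(ψ x).re⌋₊) ^ 2 ≤
      bracket N m a (∏ x, X x ^ ⌊(cfgSymP i k ψ x).re⌋₊) *
        bracket N m a (∏ x, X x ^ ⌊(cfgSymM i k ψ x).re⌋₊)
    rw [hP, hM]
    exact h
  obtain ⟨c, hc, p₀, hle⟩ := chessboard_cfg hL hS h0 hcs (φ := fun x : TorusSite ν L => ((e x : ℝ) : ℂ))
    (fun y => Finset.mem_image_of_mem (fun x : TorusSite ν L => ((e x : ℝ) : ℂ)) (Finset.mem_univ y))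
    (0 : TorusSite ν L)
  obtain ⟨x₁, -, rfl⟩ := Finset.mem_image.1 hc
  have hφ : F (fun x => ((e x : ℝ) : ℂ)) = bracket N m a (∏ x, X x ^ e x) := by
    show bracket N m a (∏ x, X x ^ ⌊(((e x : ℝ) : ℂ)).re⌋₊) = bracket N m a (∏ x, X x ^ e x)
    congr 1
    exact Finset.prod_congr rfl fun x _ => by rw [Complex.ofReal_re, Nat.floor_natCast]
  have hpat : F (pattern hL.two_dvd ((e x₁ : ℝ) : ℂ) p₀) =
      bracket N m a (∏ x : TorusSite ν L, X x ^ e x₁) := by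
    show bracket N m a (∏ x : TorusSite ν L,
        X x ^ ⌊(pattern (ν := ν) hL.two_dvd ((e x₁ : ℝ) : ℂ) p₀ x).re⌋₊) =
      bracket N m a (∏ x : TorusSite ν L, X x ^ e x₁)
    congr 1
    refine Finset.prod_congr rfl fun x _ => ?_
    unfold pattern
    split_ifs
    · rw [Complex.ofReal_re, Nat.floor_natCast]
    · rw [Complex.conj_ofReal, Complex.ofReal_re, Nat.floor_natCast]
  rw [hφ, hpat] at hle
  exact hle.trans (bracket_prod_X_pow_le_partitionFunction_of_dom hν hL hdom (e x₁))

/-- **Theorem 3.18 (1) from the one-dimer domination**: `0 ≤ ⟨∏_x σ_x^{e_x}⟩_Λ ≤ 1` for every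
exponent configuration, `m ≥ 0`, `a_n ≥ 0` with `a_0, a_N > 0` (so that `Z_Λ > 0`), even torus of
side `≥ 2`, `ν ≥ 1`. [cite: SalmhoferSeiler1991, Thm. 3.18 (1) (3.59)] -/
theorem expect_prod_X_pow_mem_Icc_of_dom (hν : 1 ≤ ν) (hL : Even L) (hL2 : 2 ≤ L) {N : ℕ}
    {m : ℝ} (hm : 0 ≤ m) {a : ℕ → ℝ} (ha : ∀ j ≤ N, 0 ≤ a j) (ha0 : 0 < a 0) (haN : 0 < a N)
    (hdom : ∀ (x : TorusSite ν L) (s : Fin ν × Bool) (Φ : MvPolynomial (TorusSite ν L) ℝ),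
      NonnegCoeff Φ → bracket N m a (X x * X (nbr x s) * Φ) ≤ bracket N m a Φ)
    (e : TorusSite ν L → ℕ) :
    expect N m a (∏ x, X x ^ e x) ∈ Set.Icc (0 : ℝ) 1 := by
  have hZ : 0 < partitionFunction (ν := ν) (L := L) N m a :=
    partitionFunction_pos hL.two_dvd hL2 hν hm ha ha0 haN
  rw [Set.mem_Icc, expect_eq_div]
  refine ⟨div_nonneg (bracket_nonneg N hm ha (NonnegCoeff.prod _ fun x _ => (NonnegCoeff.X x).pow _))
    hZ.le, ?_⟩
  rw [div_le_one hZ]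
  exact bracket_prod_X_pow_le_partitionFunction_of_dom' hν hL hm ha hdom e

/-- `σ^L` as a product over the whole torus: `monomial L 1 = ∏_x σ_x^{L_x}`. [folklore] -/
private theorem monomial_eq_prod_X_pow' (d : TorusSite ν L →₀ ℕ) :
    (monomial d (1 : ℝ) : MvPolynomial (TorusSite ν L) ℝ) = ∏ x, X x ^ d x := by
  classical
  rw [← prod_X_pow_eq_monomial, Finset.prod_subset (Finset.subset_univ d.support)]
  intro x _ hx
  rw [Finsupp.notMem_support_iff.1 hx, pow_zero]

/-- **Theorem 3.18 (1) for `σ^L = monomial L 1` from the one-dimer domination**: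
`0 ≤ ⟨σ^L⟩_Λ ≤ 1`. [cite: SalmhoferSeiler1991, Thm. 3.18 (1) (3.59)] -/
theorem expect_monomial_mem_Icc_of_dom (hν : 1 ≤ ν) (hL : Even L) (hL2 : 2 ≤ L) {N : ℕ}
    {m : ℝ} (hm : 0 ≤ m) {a : ℕ → ℝ} (ha : ∀ j ≤ N, 0 ≤ a j) (ha0 : 0 < a 0) (haN : 0 < a N)
    (hdom : ∀ (x : TorusSite ν L) (s : Fin ν × Bool) (Φ : MvPolynomial (TorusSite ν L) ℝ),
      NonnegCoeff Φ → bracket N m a (X x * X (nbr x s) * Φ) ≤ bracket N m a Φ)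
    (d : TorusSite ν L →₀ ℕ) :
    expect N m a (monomial d 1) ∈ Set.Icc (0 : ℝ) 1 := by
  rw [monomial_eq_prod_X_pow']
  exact expect_prod_X_pow_mem_Icc_of_dom hν hL hL2 hm ha ha0 haN hdom d

/-! ### `U(N)`, every `N ≥ 1`: (3.62) and Theorem 3.18 (1) -/

/-- **The dimer weights of `U(N)` grow at least like `N/n`**: `N a_{n-1} ≤ n a_n` for
`1 ≤ n ≤ N`, from `n a_n (N - n + 1) = N² a_{n-1}` (`uNBondCoeff_ratio`, (2.23)).
[cite: SalmhoferSeiler1991, (2.23)] -/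
theorem uNBondCoeff_lower_ratio {N n : ℕ} (hn1 : 1 ≤ n) (hnN : n ≤ N) :
    (N : ℝ) * uNBondCoeff N (n - 1) ≤ (n : ℝ) * uNBondCoeff N n := by
  have h := uNBondCoeff_ratio hn1 hnN
  have hNpos : (0 : ℝ) < N := by exact_mod_cast (show 0 < N by omega)
  have h0 : 0 ≤ (n : ℝ) * uNBondCoeff N n := mul_nonneg (Nat.cast_nonneg n) (uNBondCoeff_nonneg N n)
  have h1 : ((N - n + 1 : ℕ) : ℝ) ≤ N := by exact_mod_cast (show N - n + 1 ≤ N by omega)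
  have key : (N : ℝ) * ((N : ℝ) * uNBondCoeff N (n - 1)) ≤ (N : ℝ) * ((n : ℝ) * uNBondCoeff N n) :=
    calc (N : ℝ) * ((N : ℝ) * uNBondCoeff N (n - 1))
        = (n : ℝ) * uNBondCoeff N n * ((N - n + 1 : ℕ) : ℝ) := by rw [h]; ring
      _ ≤ (n : ℝ) * uNBondCoeff N n * N := mul_le_mul_of_nonneg_left h1 h0
      _ = (N : ℝ) * ((n : ℝ) * uNBondCoeff N n) := by ring
  exact le_of_mul_le_mul_left key hNpos

/-- **(3.62) for `U(N)`, EVERY `N ≥ 1`**: `[σ_xσ_yΦ]_Λ ≤ [Φ]_Λ` for every site `x`, each neighbour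
`y`, every `Φ` with nonnegative coefficients, `m ≥ 0`, side `≥ 2` — by
`bracket_X_mul_X_nbr_mul_le_of_ratio` with `c = N` (`uNBondCoeff_lower_ratio`); no `w_k ≥ 0`
(Remark 4.6) needed. [cite: SalmhoferSeiler1991, Thm. 3.18 (1) (3.62) with (2.23)] -/
theorem uN_bracket_X_mul_X_nbr_mul_le {N : ℕ} (hN : 1 ≤ N) (hL : 2 ≤ L) {m : ℝ} (hm : 0 ≤ m)
    (x : TorusSite ν L) (s : Fin ν × Bool) {Φ : MvPolynomial (TorusSite ν L) ℝ}
    (hΦ : NonnegCoeff Φ) :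
    bracket N m (uNBondCoeff N) (X x * X (nbr x s) * Φ) ≤ bracket N m (uNBondCoeff N) Φ := by
  have hNpos : (0 : ℝ) < N := Nat.cast_pos.mpr (by omega)
  have h := bracket_X_mul_X_nbr_mul_le_of_ratio (hasLog_logCoeff hN (uNBondCoeff_zero N))
    (fun k _ => uNBondCoeff_nonneg N k) (c := (N : ℝ))
    (fun n hn1 hnN => uNBondCoeff_lower_ratio hn1 hnN) hL hm x s hΦ
  exact le_of_mul_le_mul_left h hNpos

/-- **Theorem 3.18 (1) for `U(N)`, EVERY `N ≥ 1`**: `0 ≤ ⟨σ^L⟩_Λ ≤ 1` for every monomial, `m ≥ 0`,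
even torus (`ν ≥ 1`, side `≥ 2`). [cite: SalmhoferSeiler1991, Thm. 3.18 (1) (3.59) with (2.23)] -/
theorem uN_expect_monomial_mem_Icc_allN (hν : 1 ≤ ν) (hL : Even L) (hL2 : 2 ≤ L) {N : ℕ}
    (hN : 1 ≤ N) {m : ℝ} (hm : 0 ≤ m) (d : TorusSite ν L →₀ ℕ) :
    expect N m (uNBondCoeff N) (monomial d 1) ∈ Set.Icc (0 : ℝ) 1 :=
  expect_monomial_mem_Icc_of_dom hν hL hL2 hm (fun k _ => uNBondCoeff_nonneg N k)
    (by rw [uNBondCoeff_zero]; exact one_pos) (uNBondCoeff_self_pos N)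
    (fun x s _ hΦ => uN_bracket_X_mul_X_nbr_mul_le hN hL2 hm x s hΦ) d

/-- Theorem 3.18 (1) for the two-point function of `U(N)`, every `N ≥ 1`: `0 ≤ T_Λ(x) ≤ 1`.
[cite: SalmhoferSeiler1991, Thm. 3.18 (1) (3.59)] -/
theorem uN_corrFn_mem_Icc_allN (hν : 1 ≤ ν) (hL : Even L) (hL2 : 2 ≤ L) {N : ℕ} (hN : 1 ≤ N)
    {m : ℝ} (hm : 0 ≤ m) (x : TorusSite ν L) :
    corrFn N m (uNBondCoeff N) x ∈ Set.Icc (0 : ℝ) 1 := by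
  have h := uN_expect_monomial_mem_Icc_allN hν hL hL2 hN hm
    (Finsupp.single (0 : TorusSite ν L) 1 + Finsupp.single x 1)
  have hm' : (X (0 : TorusSite ν L) * X x : MvPolynomial (TorusSite ν L) ℝ) =
      monomial (Finsupp.single 0 1 + Finsupp.single x 1) 1 := by
    rw [X, X, monomial_mul, mul_one]
  rw [corrFn, hm']
  exact h

/-! ### (3.61)/(4.10) in the `a`-form; Theorem 4.3 and Corollary 4.4 for `U(N)`, every `N` -/

/-- **(3.61)/(4.10) with `ρ ≥ 0` dropped, in the monomer–dimer picture**: for `B = exp(NW)` to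
order `N ≥ 1` (ANY `w`), `a_n ≥ 0` with `c a_{n-1} ≤ n a_n` (`1 ≤ n ≤ N`), `m ≥ 0`, side `≥ 2`:
`2m[σ_x]_Λ + (c/N)∑_{|y-x|=1}[σ_xσ_y]_Λ ≤ Z_Λ`. [cite: SalmhoferSeiler1991, (3.46), (3.61) and (4.10) with (2.23)] -/
theorem sd_nbr_sum_le_of_ratio {N : ℕ} (hN : 1 ≤ N) {a w : ℕ → ℝ} (hlog : HasLog N a w)
    (ha : ∀ k ≤ N, 0 ≤ a k) {c : ℝ}
    (hc : ∀ n, 1 ≤ n → n ≤ N → c * a (n - 1) ≤ (n : ℝ) * a n) (hL : 2 ≤ L) {m : ℝ} (hm : 0 ≤ m)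
    (x : TorusSite ν L) :
    2 * m * bracket N m a (X x) + c / N * ∑ s : Fin ν × Bool, bracket N m a (X x * X (nbr x s)) ≤
      partitionFunction (ν := ν) (L := L) N m a := by
  have hNpos : (0 : ℝ) < N := Nat.cast_pos.mpr (by omega)
  rw [partitionFunction_eq_sd hN hlog hL m x, linkSum_eq_sum_nbr, bracket_sum, Finset.mul_sum]
  refine add_le_add le_rfl (Finset.sum_le_sum fun s _ => ?_)
  have h := bracket_X_mul_X_nbr_mul_le_omega_of_ratio hlog ha hc hL hm x s NonnegCoeff.one
  rw [mul_one, mul_one] at h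
  rw [div_mul_eq_mul_div, div_le_iff₀ hNpos]
  linarith

/-- **(3.61)/(4.10) for `U(N)`, EVERY `N ≥ 1`**: `2m[σ_x]_Λ + ∑_{|y-x|=1}[σ_xσ_y]_Λ ≤ Z_Λ`, i.e.
`2m⟨σ_x⟩ + ∑_y⟨σ_xσ_y⟩ ≤ 1` (`m ≥ 0`, side `≥ 2`) — together with `uN_partitionFunction_le_sharp`
(`Z_Λ ≤ 2m[σ_x] + N∑_y[σ_xσ_y]`) the two-sided dimer-picture form of (4.38)/(4.10).
[cite: SalmhoferSeiler1991, (3.61) and (4.10) with (2.23)] -/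
theorem uN_sd_nbr_sum_le {N : ℕ} (hN : 1 ≤ N) (hL : 2 ≤ L) {m : ℝ} (hm : 0 ≤ m)
    (x : TorusSite ν L) :
    2 * m * bracket N m (uNBondCoeff N) (X x) +
        ∑ s : Fin ν × Bool, bracket N m (uNBondCoeff N) (X x * X (nbr x s)) ≤
      partitionFunction (ν := ν) (L := L) N m (uNBondCoeff N) := by
  have hN0 : (N : ℝ) ≠ 0 := by exact_mod_cast (show N ≠ 0 by omega)
  have h := sd_nbr_sum_le_of_ratio hN (hasLog_logCoeff hN (uNBondCoeff_zero N))
    (fun k _ => uNBondCoeff_nonneg N k) (c := (N : ℝ))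
    (fun n hn1 hnN => uNBondCoeff_lower_ratio hn1 hnN) hL hm x
  rwa [div_self hN0, one_mul] at h

/-- **Theorem 4.3 (4.6) from the SD inequality as a hypothesis**: if `a_n ≥ 0`, `Z_Λ > 0` and
`2m[σ_x] + ∑_y[σ_xσ_y] ≤ Z_Λ` on an even torus of side `≥ 2`, then `2ν⟨σ_x⟩² + 2m⟨σ_x⟩ ≤ 1`
(each neighbour term is `≥ ⟨σ_x⟩²` by the reflection-positivity Schwarz inequality (3.56),
`expect_X_sq_le_nbr`). [cite: SalmhoferSeiler1991, Thm. 4.3 (4.6)–(4.7), (4.10)–(4.11)] -/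
theorem meanField_ineq_of_sd (hL : Even L) (hL2 : 2 ≤ L) {N : ℕ} {m : ℝ} {a : ℕ → ℝ}
    (ha : ∀ j ≤ N, 0 ≤ a j) (hZ : 0 < partitionFunction (ν := ν) (L := L) N m a)
    (x : TorusSite ν L)
    (hsd : 2 * m * bracket N m a (X x) + ∑ s : Fin ν × Bool, bracket N m a (X x * X (nbr x s)) ≤
      partitionFunction (ν := ν) (L := L) N m a) :
    2 * ν * expect N m a (X x) ^ 2 + 2 * m * expect N m a (X x) ≤ 1 := by
  have h1 : 2 * m * expect N m a (X x) + ∑ s : Fin ν × Bool, expect N m a (X x * X (nbr x s)) ≤ 1 := by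
    have h := (div_le_one hZ).2 hsd
    simp only [expect_eq_div]
    rwa [add_div, mul_div_assoc, Finset.sum_div] at h
  have h2 : 2 * (ν : ℝ) * expect N m a (X x) ^ 2 ≤
      ∑ s : Fin ν × Bool, expect N m a (X x * X (nbr x s)) := by
    calc 2 * (ν : ℝ) * expect N m a (X x) ^ 2 = ∑ _s : Fin ν × Bool, expect N m a (X x) ^ 2 := by
          rw [Finset.sum_const, Finset.card_univ, Fintype.card_prod, Fintype.card_fin,
            Fintype.card_bool, nsmul_eq_mul]
          push_cast
          ring
      _ ≤ ∑ s : Fin ν × Bool, expect N m a (X x * X (nbr x s)) :=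
          Finset.sum_le_sum fun s _ => expect_X_sq_le_nbr hL hL2 m ha hZ x s
  linarith

/-- **Theorem 4.3 (4.6) for `U(N)`, EVERY `N ≥ 1`**: `2ν⟨σ_x⟩_Λ² + 2m⟨σ_x⟩_Λ ≤ 1` in every finite
even volume (`ν ≥ 1`, side `≥ 2`, `m ≥ 0`); the print has this under Remark 4.6 (`N ≤ 5`).
[cite: SalmhoferSeiler1991, Thm. 4.3 (4.6) with (2.23)] -/
theorem uN_meanField_ineq_allN (hν : 1 ≤ ν) (hL : Even L) (hL2 : 2 ≤ L) {N : ℕ} (hN : 1 ≤ N)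
    {m : ℝ} (hm : 0 ≤ m) (x : TorusSite ν L) :
    2 * ν * expect N m (uNBondCoeff N) (X x) ^ 2 + 2 * m * expect N m (uNBondCoeff N) (X x) ≤ 1 := by
  have ha : ∀ k ≤ N, 0 ≤ uNBondCoeff N k := fun k _ => uNBondCoeff_nonneg N k
  have hZ : 0 < partitionFunction (ν := ν) (L := L) N m (uNBondCoeff N) :=
    partitionFunction_pos hL.two_dvd hL2 hν hm ha (by rw [uNBondCoeff_zero]; exact one_pos)
      (uNBondCoeff_self_pos N)
  exact meanField_ineq_of_sd hL hL2 ha hZ x (uN_sd_nbr_sum_le hN hL2 hm x)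

/-- **Theorem 4.3 (4.6)–(4.7) for `U(N)`, EVERY `N ≥ 1`: `⟨σ_x⟩_Λ ≤ s₁ = (√(m² + 2ν) - m)/(2ν)`**
(mean field is an upper bound for `⟨ψ̄ψ⟩ = 2N⟨σ_x⟩`, Cor. 4.4 (2)).
[cite: SalmhoferSeiler1991, Thm. 4.3 (4.6)–(4.7) and Cor. 4.4 (2)] -/
theorem uN_expect_X_le_meanField_allN (hν : 1 ≤ ν) (hL : Even L) (hL2 : 2 ≤ L) {N : ℕ}
    (hN : 1 ≤ N) {m : ℝ} (hm : 0 ≤ m) (x : TorusSite ν L) :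
    expect N m (uNBondCoeff N) (X x) ≤ (Real.sqrt (m ^ 2 + 2 * ν) - m) / (2 * ν) := by
  have h := uN_meanField_ineq_allN hν hL hL2 hN hm x
  set s : ℝ := expect N m (uNBondCoeff N) (X x) with hs
  have hν0 : (0 : ℝ) < ν := by exact_mod_cast hν
  have hsq : (2 * ν * s + m) ^ 2 ≤ m ^ 2 + 2 * ν := by nlinarith
  have hle : 2 * ν * s + m ≤ Real.sqrt (m ^ 2 + 2 * ν) :=
    (le_abs_self _).trans (Real.abs_le_sqrt hsq)
  rw [le_div_iff₀ (by positivity)]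
  linarith

/-- `⟨σ_x⟩_Λ ≥ 0` for `U(N)`, every `N ≥ 1` (`m ≥ 0`). [cite: SalmhoferSeiler1991, Thm. 3.18 (1) (3.59)] -/
theorem uN_expect_X_nonneg_allN (hν : 1 ≤ ν) (hL : Even L) (hL2 : 2 ≤ L) {N : ℕ} (hN : 1 ≤ N)
    {m : ℝ} (hm : 0 ≤ m) (x : TorusSite ν L) :
    0 ≤ expect N m (uNBondCoeff N) (X x) := by
  have h := uN_expect_monomial_mem_Icc_allN hν hL hL2 hN hm (Finsupp.single x 1)
  have hX : (X x : MvPolynomial (TorusSite ν L) ℝ) = monomial (Finsupp.single x 1) 1 := rfl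
  rw [hX]
  exact h.1

/-- **Cor. 4.4 (1), (3) (4.16)/(4.18) for `U(N)`, EVERY `N ≥ 1`: `⟨σ_x⟩_Λ ≤ 1/√(2ν)`**, i.e.
`⟨ψ̄ψ⟩_Λ ≤ N√(2/ν)`, at every `m ≥ 0`. [cite: SalmhoferSeiler1991, Cor. 4.4 (1) (4.16) and (3) (4.18)] -/
theorem uN_expect_X_le_inv_sqrt_allN (hν : 1 ≤ ν) (hL : Even L) (hL2 : 2 ≤ L) {N : ℕ}
    (hN : 1 ≤ N) {m : ℝ} (hm : 0 ≤ m) (x : TorusSite ν L) :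
    expect N m (uNBondCoeff N) (X x) ≤ 1 / Real.sqrt (2 * ν) := by
  have h := uN_meanField_ineq_allN hν hL hL2 hN hm x
  have h0 := uN_expect_X_nonneg_allN hν hL hL2 hN hm x
  set s : ℝ := expect N m (uNBondCoeff N) (X x) with hs
  have hν0 : (0 : ℝ) < ν := by exact_mod_cast hν
  have h2 : 2 * ν * s ^ 2 ≤ 1 := by nlinarith
  have hsqrt : 0 < Real.sqrt (2 * ν) := Real.sqrt_pos.2 (by positivity)
  rw [le_div_iff₀ hsqrt]
  have hsq : (s * Real.sqrt (2 * ν)) ^ 2 ≤ 1 := by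
    rw [mul_pow, Real.sq_sqrt (by positivity)]
    linarith
  exact (pow_le_one_iff_of_nonneg (mul_nonneg h0 hsqrt.le) two_ne_zero).1 hsq

/-- **Cor. 4.4 (3) (4.18) for `U(N)`, EVERY `N ≥ 1`**: `⟨ψ̄ψ⟩_Λ = 2N⟨σ_x⟩_Λ ≤ N · min{√(2/ν), 1/m}`
(`m > 0`), in every finite even volume. [cite: SalmhoferSeiler1991, Cor. 4.4 (3) (4.18)] -/
theorem uN_condensate_le_min_allN (hν : 1 ≤ ν) (hL : Even L) (hL2 : 2 ≤ L) {N : ℕ} (hN : 1 ≤ N)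
    {m : ℝ} (hm : 0 < m) (x : TorusSite ν L) :
    2 * N * expect N m (uNBondCoeff N) (X x) ≤ N * min (Real.sqrt (2 / ν)) (1 / m) := by
  have hN0 : (0 : ℝ) ≤ N := Nat.cast_nonneg N
  have hν0 : (0 : ℝ) < ν := by exact_mod_cast hν
  have h1 := uN_expect_X_le_inv_sqrt_allN hν hL hL2 hN hm.le x
  have h2 : 2 * m * expect N m (uNBondCoeff N) (X x) ≤ 1 := by
    have h := uN_meanField_ineq_allN hν hL hL2 hN hm.le x
    nlinarith [sq_nonneg (expect N m (uNBondCoeff N) (X x))]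
  have hsqrt : 2 * (1 / Real.sqrt (2 * ν)) = Real.sqrt (2 / ν) := by
    rw [Real.sqrt_div' 2 hν0.le, Real.sqrt_mul' 2 hν0.le]
    have h2pos : 0 < Real.sqrt 2 := Real.sqrt_pos.2 two_pos
    have hνs : 0 < Real.sqrt ν := Real.sqrt_pos.2 hν0
    field_simp
    rw [← Real.sqrt_mul_self two_pos.le, Real.sqrt_mul_self two_pos.le, Real.sq_sqrt two_pos.le]
  rw [mul_min_of_nonneg _ _ hN0]
  refine le_min ?_ ?_
  · calc 2 * N * expect N m (uNBondCoeff N) (X x) = N * (2 * expect N m (uNBondCoeff N) (X x)) := by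
          ring
      _ ≤ N * (2 * (1 / Real.sqrt (2 * ν))) := by
          exact mul_le_mul_of_nonneg_left (by linarith) hN0
      _ = N * Real.sqrt (2 / ν) := by rw [hsqrt]
  · calc 2 * N * expect N m (uNBondCoeff N) (X x)
        = N * (2 * m * expect N m (uNBondCoeff N) (X x)) / m := by
          field_simp
      _ ≤ N * 1 / m := by
          exact div_le_div_of_nonneg_right (mul_le_mul_of_nonneg_left h2 hN0) hm.le
      _ = N * (1 / m) := by ring

end Chain

/-! ### Theorem 3.18 (2) for `U(N)`, every `N` -/

section Limits

variable {ν : ℕ}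

/-- **Theorem 3.18 (2) from Theorem 3.18 (1) as a hypothesis** (the separable Banach–Alaoglu step,
as in `exists_subseq_tendsto_expect`): if `0 ≤ ⟨σ^L⟩_{Λ_n} ≤ 1` for all monomials along a sequence of
tori, then along a subsequence `⟨σ^L⟩_{Λ_{n_j}} → ⟨σ^L⟩ ∈ [0,1]` for every multi-index `L` of finite
support in `ℤ^ν` simultaneously. [cite: SalmhoferSeiler1991, Thm. 3.18 (2) (3.60), proof (3.66)–(3.68)] -/
theorem exists_subseq_tendsto_expect_of_Icc {N : ℕ} {m : ℝ} {a : ℕ → ℝ} (Ls : ℕ → ℕ)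
    [∀ n, NeZero (Ls n)]
    (hIcc : ∀ n (d : TorusSite ν (Ls n) →₀ ℕ), expect N m a (monomial d (1 : ℝ)) ∈ Set.Icc (0 : ℝ) 1) :
    ∃ φ : ℕ → ℕ, StrictMono φ ∧ ∃ c : (Site ν →₀ ℕ) → ℝ, ∀ d : Site ν →₀ ℕ,
      c d ∈ Set.Icc (0 : ℝ) 1 ∧
        Filter.Tendsto (fun n => expect N m a
          (monomial (Finsupp.mapDomain (Torus.proj (Ls (φ n))) d) (1 : ℝ) :
            MvPolynomial (TorusSite ν (Ls (φ n))) ℝ)) Filter.atTop (nhds (c d)) := by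
  classical
  set u : ℕ → ((Site ν →₀ ℕ) → ℝ) := fun n d => expect N m a
    (monomial (Finsupp.mapDomain (Torus.proj (Ls n)) d) (1 : ℝ) :
      MvPolynomial (TorusSite ν (Ls n)) ℝ) with hu
  set K : Set ((Site ν →₀ ℕ) → ℝ) := Set.pi Set.univ fun _ => Set.Icc (0 : ℝ) 1 with hK
  have hKc : IsCompact K := isCompact_univ_pi fun _ => isCompact_Icc
  have huK : ∀ n, u n ∈ K := fun n => by
    simp only [hK, Set.mem_pi, Set.mem_univ, forall_true_left]
    intro d
    exact hIcc n _
  obtain ⟨c, hcK, φ, hφ, hlim⟩ := hKc.isSeqCompact huK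
  refine ⟨φ, hφ, c, fun d => ⟨?_, ?_⟩⟩
  · simpa [hK] using hcK d (Set.mem_univ d)
  · have h := tendsto_pi_nhds.1 hlim d
    exact h

/-- Even and nonzero ⇒ `≥ 2`. [folklore] -/
private theorem two_le_of_even' {L : ℕ} [NeZero L] (hL : Even L) : 2 ≤ L := by
  have := NeZero.ne L
  obtain ⟨k, hk⟩ := hL
  omega

/-- **Theorem 3.18 (2) for the `U(N)` model, EVERY `N ≥ 1`**: thermodynamic limits of all
correlations along a subsequence of any sequence of even tori. [cite: SalmhoferSeiler1991, Thm. 3.18 (2) (3.60)] -/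
theorem uN_exists_subseq_tendsto_expect_allN (hν : 1 ≤ ν) {N : ℕ} (hN : 1 ≤ N)
    {m : ℝ} (hm : 0 ≤ m) (Ls : ℕ → ℕ) [∀ n, NeZero (Ls n)] (hev : ∀ n, Even (Ls n)) :
    ∃ φ : ℕ → ℕ, StrictMono φ ∧ ∃ c : (Site ν →₀ ℕ) → ℝ, ∀ d : Site ν →₀ ℕ,
      c d ∈ Set.Icc (0 : ℝ) 1 ∧
        Filter.Tendsto (fun n => expect N m (uNBondCoeff N)
          (monomial (Finsupp.mapDomain (Torus.proj (Ls (φ n))) d) (1 : ℝ) :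
            MvPolynomial (TorusSite ν (Ls (φ n))) ℝ)) Filter.atTop (nhds (c d)) :=
  exists_subseq_tendsto_expect_of_Icc Ls fun n d =>
    uN_expect_monomial_mem_Icc_allN hν (hev n) (two_le_of_even' (hev n)) hN hm d

/-- `Torus.proj L 0 = 0`. [folklore] -/
private theorem torus_proj_zero' (L : ℕ) : Torus.proj L (0 : Site ν) = 0 := by
  funext i; simp [Torus.proj]

/-- The two-point observable read through the projection: `σ^{δ₀+δ_x}` on `Λ_n` is `σ₀σ_{x mod L}`.
[cite: SalmhoferSeiler1991, Thm. 3.18 (2)] -/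
private theorem monomial_proj_pair' (L : ℕ) [NeZero L] (x : Site ν) :
    (monomial (Finsupp.mapDomain (Torus.proj L) (Finsupp.single (0 : Site ν) 1 + Finsupp.single x 1))
      (1 : ℝ) : MvPolynomial (TorusSite ν L) ℝ) = X 0 * X (Torus.proj L x) := by
  rw [Finsupp.mapDomain_add, Finsupp.mapDomain_single, Finsupp.mapDomain_single, torus_proj_zero',
    X, X, monomial_mul, mul_one]

variable (Ls : ℕ → ℕ) [∀ n, NeZero (Ls n)]

/-- **Theorem 3.18 (2) for the two-point function of `U(N)`, every `N ≥ 1`**: along a subsequence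
of any sequence of even tori, `T_Λ(x) → T(x)` for every `x ∈ ℤ^ν`. [cite: SalmhoferSeiler1991, Thm. 3.18 (2) (3.60)] -/
theorem uN_exists_subseq_tendsto_corrFn_allN (hν : 1 ≤ ν) {N : ℕ} (hN : 1 ≤ N) {m : ℝ}
    (hm : 0 ≤ m) (hev : ∀ n, Even (Ls n)) :
    ∃ φ : ℕ → ℕ, StrictMono φ ∧ ∃ T : Site ν → ℝ, ∀ x,
      Tendsto (fun n => corrFn (L := Ls (φ n)) N m (uNBondCoeff N) (Torus.proj (Ls (φ n)) x))
        atTop (nhds (T x)) := by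
  obtain ⟨φ, hφ, c, hc⟩ := uN_exists_subseq_tendsto_expect_allN hν hN hm Ls hev
  refine ⟨φ, hφ, fun x => c (Finsupp.single 0 1 + Finsupp.single x 1), fun x => ?_⟩
  have h := (hc (Finsupp.single 0 1 + Finsupp.single x 1)).2
  simp_rw [monomial_proj_pair'] at h
  exact h

/-! ### Theorem 3.21 / (3.109) for every thermodynamic limit, `U(N)`, every `N` -/

/-- **Thm. 3.21 in the thermodynamic limit for the `U(N)` model, EVERY `N ≥ 1`** (the twin of
`uN_thermodynamicLimit_infraredBound` without `N ≤ 4`): the infrared bound (3.74)/(3.75) for every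
pointwise thermodynamic limit `T` of the two-point function along even tori — it needs only
`b_k ≥ 0`, which is Remark 4.5 (`uN_fluctCoeff_nonneg`, every `N`).
[cite: SalmhoferSeiler1991, Thm. 3.21 (3.74)–(3.75) with Remark 4.5 and Thm. 3.23 (1) (3.109)] -/
theorem uN_thermodynamicLimit_infraredBound_allN (hν : 1 ≤ ν) {N : ℕ} (hN : 1 ≤ N) {m : ℝ}
    (hev : ∀ n, Even (Ls n)) (hLs : Tendsto Ls atTop atTop) {T : Site ν → ℝ}
    (hT : ∀ x, Tendsto (fun n => corrFn (L := Ls n) N m (uNBondCoeff N) (Torus.proj (Ls n) x))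
      atTop (nhds (T x)))
    (S : Finset (Site ν)) (φ : Site ν → ℝ) (hφ : ∀ x, x ∉ S → φ x = 0) :
    (∑ x ∈ nbhd S, ∑ y ∈ nbhd S, latStencil (-1) φ x * T (y - x) * latStencil (-1) φ y ≤
      1 / N * ∑ x ∈ S, φ x * latStencil (-1) φ x) ∧
    (-(1 / N * ∑ x ∈ S, φ x * latStencil 1 φ x) ≤
      ∑ x ∈ nbhd S, ∑ y ∈ nbhd S, latStencil 1 φ x * T (y - x) * latStencil 1 φ y) :=
  thermodynamicLimit_infraredBound hν hN (fun k hk => uN_fluctCoeff_nonneg hN k hk) Ls hev hLs hT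
    S φ hφ

/-! ### Theorem 4.8 / Remark 4.10 (1) in the thermodynamic limit from a finite-volume lower bound -/

/-- The line `k ↦ (k, 0, …, 0)` in `ℤ^ν` is injective. [folklore] -/
private theorem single_axis_injective' (hν : 1 ≤ ν) :
    Function.Injective fun k : ℤ => (Pi.single (⟨0, hν⟩ : Fin ν) k : Site ν) := by
  intro k k' h
  have := congrFun h ⟨0, hν⟩
  simpa using this

/-- `∑_μ (k e₀)_μ = k`. [folklore] -/
private theorem sum_single_axis' (hν : 1 ≤ ν) (k : ℤ) :
    ∑ i, (Pi.single (⟨0, hν⟩ : Fin ν) k : Site ν) i = k := by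
  rw [Finset.sum_eq_single (⟨0, hν⟩ : Fin ν)]
  · simp
  · intro i _ hi; simp [Pi.single_eq_of_ne hi]
  · intro h; exact absurd (Finset.mem_univ _) h

/-- The odd sublattice of `ℤ^ν` is infinite (`ν ≥ 1`). [folklore] -/
private theorem infinite_latSgn_eq_neg_one' (hν : 1 ≤ ν) :
    {x : Site ν | latSgn x = -1}.Infinite := by
  have hinj : Function.Injective fun k : ℤ => (Pi.single (⟨0, hν⟩ : Fin ν) (2 * k + 1) : Site ν) :=
    fun k k' h => by simpa using single_axis_injective' hν h
  refine Set.infinite_of_injective_forall_mem hinj fun k => ?_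
  simp only [Set.mem_setOf_eq, latSgn, sum_single_axis', Int.not_even_two_mul_add_one, if_false]

/-- `ℤ^ν` is infinite for `ν ≥ 1`. [folklore] -/
private theorem infinite_site' (hν : 1 ≤ ν) : Infinite (Site ν) :=
  Infinite.of_injective _ (single_axis_injective' hν)

/-- `ε(x) = 1` iff `∑ x_μ` is even. [cite: SalmhoferSeiler1991, (2.8)] -/
private theorem latSgn_eq_one_iff' (x : Site ν) : latSgn x = 1 ↔ Even (∑ i, x i) := by
  unfold latSgn
  constructor
  · intro h; by_contra hne; rw [if_neg hne] at h; norm_num at h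
  · intro h; rw [if_pos h]

/-- **Theorem 4.8 / Remark 4.10 (1) (4.43) in the thermodynamic limit, from three finite-volume
inputs**: `b_k ≥ 0` (Thm. 3.21's hypothesis, Remark 4.5), `0 ≤ T_Λ ≤ 1` on even tori (Thm. 3.18 (1)),
and a uniform lower bound `c ≤ |Λ|⁻¹∑_x T_Λ(x)` on all large even tori (the finite-volume (4.42)).
Then for `ν ≥ 3`, `m = 0` and every thermodynamic limit `T` of `T_Λ(x) = ⟨σ₀σ_x⟩_Λ` along even tori
`Λ_n → ∞`: with `c₀ = lim |Λ_n|⁻¹∑_x T_{Λ_n}(x)` (`= c_π̂` by (3.106)), `c ≤ c₀`, `T = 0` on the even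
sublattice ((3.101)), `T(x) → 2c₀` along the odd sublattice and `limsup_x T(x) = 2c₀` (4.43).  Proof
as in `chiralLRO_thermodynamicLimit` (Thm. 3.23 (1) in the form `thermodynamicLimit_twoPoint_decomp`).
[cite: SalmhoferSeiler1991, Thm. 4.8 (4.42) and Remark 4.10 (1) (4.43) with Thm. 3.23 (1)] -/
theorem chiralLRO_thermodynamicLimit_of_lowerBound (hν : 3 ≤ ν) {N : ℕ} (hN : 1 ≤ N) {a : ℕ → ℝ}
    (hb : ∀ k ≤ N, 0 ≤ fluctCoeff N a k)
    (h01 : ∀ (L : ℕ) [NeZero L], Even L → ∀ x : TorusSite ν L, corrFn N 0 a x ∈ Set.Icc (0 : ℝ) 1)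
    {c : ℝ} (hlow : ∃ L₀ : ℕ, ∀ (L : ℕ) [NeZero L], Even L → L₀ ≤ L →
      c ≤ zeroMode (ν := ν) (L := L) N 0 a)
    (hev : ∀ n, Even (Ls n)) (hLs : Tendsto Ls atTop atTop) {T : Site ν → ℝ}
    (hT : ∀ x, Tendsto (fun n => corrFn (L := Ls n) N 0 a (Torus.proj (Ls n) x)) atTop (nhds (T x))) :
    ∃ c₀ : ℝ, c ≤ c₀ ∧ 0 ≤ c₀ ∧
      Tendsto (fun n => zeroMode (ν := ν) (L := Ls n) N 0 a) atTop (nhds c₀) ∧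
      Tendsto (fun n => stagMode (ν := ν) (L := Ls n) (hev n).two_dvd N 0 a) atTop (nhds (-c₀)) ∧
      (∀ x, latSgn x = 1 → T x = 0) ∧
      Tendsto T (cofinite ⊓ 𝓟 {x | latSgn x = -1}) (nhds (2 * c₀)) ∧
      (∀ ε, 0 < ε → ∀ᶠ x in cofinite, T x ≤ 2 * c₀ + ε) ∧
      (∀ ε, 0 < ε → ∃ᶠ x in cofinite, 2 * c₀ - ε ≤ T x) ∧
      Filter.limsup T cofinite = 2 * c₀ := by
  classical
  have hν1 : 1 ≤ ν := by omega
  haveI : Infinite (Site ν) := infinite_site' hν1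
  obtain ⟨c₀, cπ, hc0, hcπ, hc, hc', hR⟩ :=
    thermodynamicLimit_twoPoint_decomp Ls hν hN hb hev hLs hT fun n x => by
      have h := h01 (Ls n) (hev n) x
      rw [abs_le]
      exact ⟨by linarith [h.1], h.2⟩
  -- `c_π̂ = c₀` by (3.106)
  have hππ : cπ = c₀ := by
    have h1 : Tendsto (fun n => stagMode (ν := ν) (L := Ls n) (hev n).two_dvd N 0 a) atTop
        (nhds (-c₀)) := by
      have := hc.neg
      refine this.congr fun n => ?_
      rw [stagMode_zero_mass (hev n).two_dvd hν1]
    have := tendsto_nhds_unique hc' h1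
    linarith
  subst hππ
  -- `T = 0` on the even sublattice, (3.101)
  have heven : ∀ x, latSgn x = 1 → T x = 0 := by
    intro x hx
    have h0 : ∀ n, corrFn (L := Ls n) N 0 a (Torus.proj (Ls n) x) = 0 := fun n =>
      corrFn_zero_mass_eq_zero (hev n).two_dvd hν1 N a
        ((parity_proj_eq_zero_iff (hev n).two_dvd x).2 ((latSgn_eq_one_iff' x).1 hx))
    have := hT x
    simp_rw [h0] at this
    exact tendsto_nhds_unique this tendsto_const_nhds
  -- on the odd sublattice `R = T - 2c₀`
  have hodd : ∀ x, latSgn x = -1 → T x - (cπ - cπ * latSgn x) = T x - 2 * cπ := by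
    intro x hx; rw [hx]; ring
  have hTodd : Tendsto T (cofinite ⊓ 𝓟 {x | latSgn x = -1}) (nhds (2 * cπ)) := by
    have h1 : Tendsto (fun x => T x - (cπ - cπ * latSgn x)) (cofinite ⊓ 𝓟 {x | latSgn x = -1})
        (nhds 0) := hR.mono_left inf_le_left
    have h2 : Tendsto (fun x => T x - 2 * cπ) (cofinite ⊓ 𝓟 {x | latSgn x = -1}) (nhds 0) := by
      refine h1.congr' ?_
      exact eventually_inf_principal.2 (Eventually.of_forall fun x hx => hodd x hx)
    have h3 := h2.add_const (2 * cπ)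
    simp only [zero_add, sub_add_cancel] at h3
    exact h3
  -- eventually `T ≤ 2c₀ + ε`
  have hup : ∀ ε, 0 < ε → ∀ᶠ x in cofinite, T x ≤ 2 * cπ + ε := by
    intro ε hε
    filter_upwards [(Metric.tendsto_nhds.1 hR) ε hε] with x hx
    rw [Real.dist_eq, sub_zero] at hx
    rcases latSgn_eq_one_or x with h1 | h1
    · rw [heven x h1]; linarith
    · rw [hodd x h1] at hx
      have := (abs_lt.1 hx).2
      linarith
  -- frequently `T ≥ 2c₀ - ε`
  have hlow' : ∀ ε, 0 < ε → ∃ᶠ x in cofinite, 2 * cπ - ε ≤ T x := by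
    intro ε hε
    have hfr : ∃ᶠ x : Site ν in cofinite, latSgn x = -1 :=
      frequently_cofinite_iff_infinite.2 (infinite_latSgn_eq_neg_one' hν1)
    refine (hfr.and_eventually ((Metric.tendsto_nhds.1 hR) ε hε)).mono fun x hx => ?_
    obtain ⟨h1, h2⟩ := hx
    rw [Real.dist_eq, sub_zero, hodd x h1] at h2
    have := (abs_lt.1 h2).1
    linarith
  -- the lower bound on `c₀`
  have hbound : c ≤ cπ := by
    obtain ⟨L₀, hL₀⟩ := hlow
    have hevn : ∀ᶠ n in atTop, c ≤ zeroMode (ν := ν) (L := Ls n) N 0 a := by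
      filter_upwards [hLs.eventually_ge_atTop L₀] with n hn
      exact hL₀ (Ls n) (hev n) hn
    exact ge_of_tendsto hc hevn
  -- the limsup
  have hlimsup : Filter.limsup T cofinite = 2 * cπ := by
    have hT01 : ∀ x, T x ∈ Set.Icc (0 : ℝ) 1 := fun x =>
      isClosed_Icc.mem_of_tendsto (hT x) (Eventually.of_forall fun n => h01 (Ls n) (hev n) _)
    have hbdd : IsBoundedUnder (· ≤ ·) cofinite T := isBoundedUnder_of ⟨1, fun x => (hT01 x).2⟩
    have hcobdd : IsCoboundedUnder (· ≤ ·) cofinite T :=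
      isCoboundedUnder_le_of_eventually_le cofinite (Eventually.of_forall fun x => (hT01 x).1)
    apply le_antisymm
    · refine le_of_forall_pos_le_add fun ε hε => ?_
      exact limsup_le_of_le hcobdd (hup ε hε)
    · refine le_of_forall_pos_le_add fun ε hε => ?_
      have := le_limsup_of_frequently_le (hlow' ε hε) hbdd
      linarith
  exact ⟨cπ, hbound, hc0, hc, hc', heven, hTodd, hup, hlow', hlimsup⟩

/-! ### Corollary 4.9 with Remark 4.10 (1) for `U(N)`, every `N ≥ 1` -/

/-- **Corollary 4.9 with Remark 4.10 (1), `U(N)`, EVERY `N ≥ 1`, `ν ≥ 4` — in the thermodynamic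
limit, with the explicit constant**: for the `β = 0` `U(N)` lattice gauge theory with one massless
staggered fermion in its complex-spin form, every thermodynamic limit `T` of `⟨σ₀σ_x⟩_Λ` along even
tori `Λ_n → ∞` vanishes on the even sublattice and converges along the odd sublattice to
`2c₀ = limsup_x T(x)`, where `c₀ = lim |Λ_n|⁻¹∑_x⟨σ₀σ_x⟩_{Λ_n} ≥ 3/(80νN) > 0` (the tree's all-`N`
finite-volume bound `uN_chiralLRO_allN_explicit`: Schwinger–Dyson constant `N` in place of `K(N)`,
kernel certificate `S(ν) < 7/20`).  The print has this for `N ≤ 3, 4` (Cor. 4.9 with the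
computer-assisted Prop. 4.2 (4)); the extension to every `N` is the tree's.
[cite: SalmhoferSeiler1991, Cor. 4.9 and Remark 4.10 (1) (4.43)] -/
theorem uN_chiralLRO_thermodynamicLimit_allN_explicit {N : ℕ} (hN : 1 ≤ N) (hν : 4 ≤ ν)
    (hev : ∀ n, Even (Ls n)) (hLs : Tendsto Ls atTop atTop) {T : Site ν → ℝ}
    (hT : ∀ x, Tendsto (fun n => corrFn (L := Ls n) N 0 (uNBondCoeff N) (Torus.proj (Ls n) x))
      atTop (nhds (T x))) :
    ∃ c₀ : ℝ, 3 / (80 * ν * N) ≤ c₀ ∧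
      Tendsto (fun n => zeroMode (ν := ν) (L := Ls n) N 0 (uNBondCoeff N)) atTop (nhds c₀) ∧
      Tendsto (fun n => stagMode (ν := ν) (L := Ls n) (hev n).two_dvd N 0 (uNBondCoeff N)) atTop
        (nhds (-c₀)) ∧
      (∀ x, latSgn x = 1 → T x = 0) ∧
      Tendsto T (cofinite ⊓ 𝓟 {x | latSgn x = -1}) (nhds (2 * c₀)) ∧
      (∀ ε, 0 < ε → ∀ᶠ x in cofinite, T x ≤ 2 * c₀ + ε) ∧
      (∀ ε, 0 < ε → ∃ᶠ x in cofinite, 2 * c₀ - ε ≤ T x) ∧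
      Filter.limsup T cofinite = 2 * c₀ := by
  have hν1 : 1 ≤ ν := by omega
  obtain ⟨L₀, hL₀⟩ := uN_chiralLRO_allN_explicit (ν := ν) hN hν
  obtain ⟨c₀, hcc, -, hc, hc', heven, hTodd, hup, hlow, hlimsup⟩ :=
    chiralLRO_thermodynamicLimit_of_lowerBound Ls (by omega) hN
      (fun k hk => uN_fluctCoeff_nonneg hN k hk)
      (fun L _ hL x => uN_corrFn_mem_Icc_allN hν1 hL (two_le_of_even' hL) hN le_rfl x)
      ⟨L₀, fun L _ hL hLe => hL₀ L hL hLe⟩ hev hLs hT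
  exact ⟨c₀, hcc, hc, hc', heven, hTodd, hup, hlow, hlimsup⟩

/-- **Corollary 4.9 with Remark 4.10 (1), `U(N)`, EVERY `N ≥ 1`, `ν ≥ 4` — in the thermodynamic
limit** (the twin of `uN_chiralLRO_thermodynamicLimit` without `N ≤ 4`): every thermodynamic limit
`T` of `⟨σ₀σ_x⟩_Λ` at `m = 0` along even tori `Λ_n → ∞` vanishes on the even sublattice and converges
along the odd sublattice to `2c₀ = limsup_x T(x) > 0`, `c₀ = lim |Λ_n|⁻¹∑_x⟨σ₀σ_x⟩_{Λ_n}`.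
[cite: SalmhoferSeiler1991, Cor. 4.9 and Remark 4.10 (1) (4.43)] -/
theorem uN_chiralLRO_thermodynamicLimit_allN {N : ℕ} (hN : 1 ≤ N) (hν : 4 ≤ ν)
    (hev : ∀ n, Even (Ls n)) (hLs : Tendsto Ls atTop atTop) {T : Site ν → ℝ}
    (hT : ∀ x, Tendsto (fun n => corrFn (L := Ls n) N 0 (uNBondCoeff N) (Torus.proj (Ls n) x))
      atTop (nhds (T x))) :
    ∃ c₀ : ℝ, 0 < c₀ ∧
      Tendsto (fun n => zeroMode (ν := ν) (L := Ls n) N 0 (uNBondCoeff N)) atTop (nhds c₀) ∧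
      (∀ x, latSgn x = 1 → T x = 0) ∧
      Tendsto T (cofinite ⊓ 𝓟 {x | latSgn x = -1}) (nhds (2 * c₀)) ∧
      Filter.limsup T cofinite = 2 * c₀ := by
  have hνpos : (0 : ℝ) < ν := by exact_mod_cast (show 0 < ν by omega)
  have hNpos : (0 : ℝ) < N := by exact_mod_cast hN
  obtain ⟨c₀, hcc, hc, -, heven, hTodd, -, -, hlimsup⟩ :=
    uN_chiralLRO_thermodynamicLimit_allN_explicit Ls hN hν hev hLs hT
  have hpos : (0 : ℝ) < 3 / (80 * ν * N) := by positivity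
  exact ⟨c₀, lt_of_lt_of_le hpos hcc, hc, heven, hTodd, hlimsup⟩

/-- **Corollary 4.9 and Remark 4.10 (1) AS PRINTED, for `U(N)` with EVERY `N ≥ 1` (`ν ≥ 4`)** (the
twin of `uN_chiralLRO_infiniteVolume` without `N ≤ 4`): for every sequence of even tori
`Λ_n = (ℤ/L_n)^ν`, `L_n → ∞`, there are a subsequence and a thermodynamic limit `T` of the `m = 0`
two-point function `⟨σ₀σ_x⟩_Λ = ⟨(ψ̄ψ(0)/2N)(ψ̄ψ(x)/2N)⟩_Λ` of the `β = 0` `U(N)` theory with massless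
staggered fermions (bosonised form, (2.21)), and for EVERY such limit
`lim_{|x|→∞, ε(x)=-1} T(x) = limsup_x T(x) = 2c₀ > 0` (4.43) while `T = 0` on the even sublattice:
chiral long-range order in the infinite volume, for every number of colours.  Honest scope:
`β = 0`, finite even tori and their pointwise limits; the identification with the gauge theory is
`StrongCouplingBosonisation` (`fermiExpect_spinObs`); nothing about `β > 0`, the continuum or `SU(N)`.
[cite: SalmhoferSeiler1991, Cor. 4.9 and Remark 4.10 (1) (4.43)] -/
theorem uN_chiralLRO_infiniteVolume_allN {N : ℕ} (hN : 1 ≤ N) (hν : 4 ≤ ν)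
    (hev : ∀ n, Even (Ls n)) (hLs : Tendsto Ls atTop atTop) :
    (∃ φ : ℕ → ℕ, StrictMono φ ∧ ∃ T : Site ν → ℝ, ∀ x,
      Tendsto (fun n => corrFn (L := Ls (φ n)) N 0 (uNBondCoeff N) (Torus.proj (Ls (φ n)) x))
        atTop (nhds (T x))) ∧
    (∀ (φ : ℕ → ℕ), StrictMono φ → ∀ T : Site ν → ℝ,
      (∀ x, Tendsto (fun n => corrFn (L := Ls (φ n)) N 0 (uNBondCoeff N) (Torus.proj (Ls (φ n)) x))
        atTop (nhds (T x))) →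
      ∃ c₀ : ℝ, 0 < c₀ ∧ (∀ x, latSgn x = 1 → T x = 0) ∧
        Tendsto T (cofinite ⊓ 𝓟 {x | latSgn x = -1}) (nhds (2 * c₀)) ∧
        Filter.limsup T cofinite = 2 * c₀) := by
  refine ⟨uN_exists_subseq_tendsto_corrFn_allN Ls (by omega) hN le_rfl hev, ?_⟩
  intro φ hφ T hT
  haveI : ∀ n, NeZero (Ls (φ n)) := fun n => inferInstance
  obtain ⟨c₀, hc0, -, heven, hTodd, hlimsup⟩ := uN_chiralLRO_thermodynamicLimit_allN
    (fun n => Ls (φ n)) hN hν (fun n => hev (φ n)) (hLs.comp hφ.tendsto_atTop) hT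
  exact ⟨c₀, hc0, heven, hTodd, hlimsup⟩

end Limits

end ComplexSpin

end Literature.MathematicalPhysics.StatisticalMechanics

end
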